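import Summits.QuantumFields.YangMills.Theorems.BalabanUVNodesN07P0FixedPointIsRecordMinimiserAtChart
import Summits.QuantumFields.YangMills.Theorems.BalabanUVNodesRootedGaugeCentred

/-!
# N07 ∕ P0 (b) knit, PART IV — the map of record READ IN THE CENTRED ROOTED NORMAL FORM (★★★ director-ym №515 exit (α), DEF-1's `…RootedGaugeCentred` ✓p812610):
# every background field of `V` (and the selector of record `UkSel … V`), re-centred by `rootGaugeC k`, IS `rootGaugeC k (Φ A⋆(V))` — the chart image of [15] Prop. 6's fixed point

WHAT.  Parts I–III (✓p811578 ∕ ✓p811739 ∕ ✓p812090) derived, from the displayed chart tokens of a P0 scheme `S : BgScheme F N 𝒴 𝒵 K k` (def-Y ✓p811606 ∕ ✓p811738) — chart range in the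
regular fibre (rng), coverage up to the residual gauge (cov), «chart minimiser ⇒ ball solution of (116)» (c→s), «the fixed point minimises on the chart» (min) and `S.RegimeTok` — the record's
uniqueness token `UniqueUkOrbit`, the background property of `S.chartCfg V = S.chart V (S.sol V)`, and the named map `UkSel F N K k ε V = rootGauge k (S.chartCfg V)` in the tree's WRAPPING rooted
gauge `T4RootedResidualGauge.rootGauge`.  Director-ym №515 found the wrapping normal form's single-volume objects false-shaped (W-wrap) and commissioned exit (α): DEF-1's CENTRED rooted normal
form `RootedGaugeCentred.rootGaugeC k U = U^{g_U}` (signed in-block comb; `rootGaugeC_eq_of_orbitRel`, `rootGaugeC_rootGauge`), in which ed.17∕FILE B re-reads the record's background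
`recordBgFieldC := rootGaugeC (k+1) (recordBgField …)` = `rootGaugeC (k+1) (UkSel …)` WITHOUT re-pointing the selector.  This file is the ~20-line instantiation promised on (α)'s landing:
* §1 (NODE 00 level, scheme-free) `rootGaugeC_eq_rootGaugeC_of_isBackground` — on the uniqueness domain any two background fields of `V` have the same centred normal form;
  `rootGaugeC_ukSel_eq_rootGaugeC_of_isBackground` — so does the selector of record: `rootGaugeC k (UkSel … V) = rootGaugeC k U₀` for EVERY background `U₀` (standing range `k ≤ m + K`);
* §2 (at a P0 scheme, Φ := `S.chart V`) `rootGaugeC_eq_chartCfg_of_isBackground_of_tokens_chart` — SELECTOR-FREE: every background field `U₀` of `V ∈ S.dom` satisfies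
  `rootGaugeC k U₀ = rootGaugeC k (S.chartCfg V)`; `rootGaugeC_ukSel_eq_chartCfg_of_tokens_chart` — the centred selector of record IS `rootGaugeC k (S.chartCfg V)`.
So every `rootGaugeC ∘ UkSel`-valued object of the record (DEF-1's `recordBgFieldC`, `recordDC`, `recordHrC`, `recordGkLC`) reads, on `S.dom` and under the tokens, the centred chart image of the
analytic fixed-point map `V ↦ S.sol V` (Part I §3 ∕ Part II `analyticOnNhd_selector_coords_of_eqOn` supply analyticity of coordinates that factor through `S.sol`).

HONEST FRAMING (binding).  By-name composition of Parts I–III with DEF-1's two centred-gauge lemmas; the tokens (rng)(cov)(c→s)(min) + `S.RegimeTok` remain HYPOTHESES (displayed, inhabited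
nowhere — no lattice instance of `BgScheme` exists in the tree; def-Y's M1 carriers ✓p812048 ∕ ✓p812124 ∕ ✓p812270 ∕ ✓p812960 are the road to one); [15] Prop. 6's global-minimality half is
UNPRINTED (D-B11-2); nothing of Bałaban asserted; P0 OPEN; port rows 27930 ∕ 26648 OPEN (27930's `stub_LZdet` BLOCKED-ON P0), 27931 CLOSED implication-only; N07 NOT discharged; K0ᴬ ∕ K1ᴬ ∕ K3ᴬ
OPEN; COUNT 8∕28 · K 1∕4 UNMOVED; helper lane, count-neutral; R4 = the CONDITIONAL finite-𝕋⁴ rung `BalabanLadder.UV` at fixed `ε = L^(−K)` only — NOT continuum ∕ ℝ⁴ ∕ OS; the Yang–Mills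
mass gap (Clay) is NOT proved by any of this.  Standard axioms only.
-/

noncomputable section

open Set

namespace Summit.QuantumFields.YangMills.Theorems.N07P0FixedPointIsRecordMinimiser

open Literature.MathematicalPhysics.QuantumFieldTheory.Balaban1983to89
open Literature.MathematicalPhysics.QuantumFieldTheory.Balaban1983to89.Node00
open Literature.MathematicalPhysics.QuantumFieldTheory.Balaban1983to89.T4Continuum (T4Family)
open Literature.MathematicalPhysics.QuantumFieldTheory.Balaban1983to89.B12GaugeOrbits021 (OrbitRel)
open Literature.MathematicalPhysics.QuantumFieldTheory.Balaban1983to89.T4RootedResidualGauge (rootGauge)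
open Literature.MathematicalPhysics.QuantumFieldTheory.Balaban1983to89.B11Prop6Scheme (mapT)
open Summit.QuantumFields.YangMills.Theorems.RootedGaugeCentred (rootGaugeC rootGaugeC_eq_of_orbitRel rootGaugeC_rootGauge)
open GaugeField (gaugeAct)

/-! ## §1  NODE 00 level (scheme-free): the centred normal form of the background is well defined on the uniqueness domain, and the selector of record re-centres to it -/

section Node00

variable {F : T4Family} {N : ℕ} [NeZero N] {K k : ℕ} {ε : ℝ} {V : GaugeField (F.P K) k (SU N)}

/-- On the uniqueness domain (`UniqueUkOrbit … V`: any two background fields of `V` are `k`-residually gauge equivalent) ANY two background fields have the SAME centred rooted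
normal form (DEF-1's `rootGaugeC_eq_of_orbitRel`). [cite: Balaban1987RG1, (0.21) p.256, p.260 («a configuration in the minimal orbit»); Balaban1985Variational, (19) p.281] -/
theorem rootGaugeC_eq_rootGaugeC_of_isBackground (hu : UniqueUkOrbit F N K k ε V) {U₀ U₁ : GaugeField (F.P K) 0 (SU N)}
    (h₀ : IsBackground (avOfRecord F N K) (bgReg F N K k ε) k V U₀) (h₁ : IsBackground (avOfRecord F N K) (bgReg F N K k ε) k V U₁) :
    rootGaugeC k U₀ = rootGaugeC k U₁ :=
  rootGaugeC_eq_of_orbitRel (hu U₁ U₀ h₁ h₀)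

/-- **THE SELECTOR OF RECORD, RE-CENTRED, IS THE CENTRED NORMAL FORM OF ANY BACKGROUND FIELD** (standing range `k ≤ m + K`): `rootGaugeC k (UkSel F N K k ε V) = rootGaugeC k U₀` for every
background `U₀` of `V` on the uniqueness domain — `UkSel … V = rootGauge k U₀` (`rootGauge_eq_UkSel_of_isBackground`) and centring the wrapping normal form gives the centred one
(`rootGaugeC_rootGauge`).  This is the rewrite DEF-1's `recordBgFieldC := rootGaugeC (k+1) (recordBgField …)` consumes. [cite: Balaban1987RG1, (0.21) p.256; Balaban1985Variational, Thm 1 p.279, (19) p.281] -/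
theorem rootGaugeC_ukSel_eq_rootGaugeC_of_isBackground (hk : k ≤ (F.P K).m + (F.P K).K) (hu : UniqueUkOrbit F N K k ε V) {U₀ : GaugeField (F.P K) 0 (SU N)}
    (h₀ : IsBackground (avOfRecord F N K) (bgReg F N K k ε) k V U₀) : rootGaugeC k (UkSel F N K k ε V) = rootGaugeC k U₀ := by
  rw [← rootGauge_eq_UkSel_of_isBackground hk hu h₀, rootGaugeC_rootGauge hk]

end Node00

/-! ## §2  At a P0 scheme, Φ := `S.chart V`: the centred background of record IS the centred chart image of [15] Prop. 6's fixed point -/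

section Scheme

variable {F : T4Family} {N : ℕ} [NeZero N] {𝒴 𝒵 : Type} [NormedAddCommGroup 𝒴] [NormedSpace ℂ 𝒴] [CompleteSpace 𝒴] [NormedAddCommGroup 𝒵] [NormedSpace ℂ 𝒵]
variable {K k : ℕ} {S : BgScheme F N 𝒴 𝒵 K k} {ε : ℝ} {V : GaugeField (F.P K) k (SU N)} {Kc : Set 𝒴}

/-- ★★ **SELECTOR-FREE CENTRED READING**: under the chart tokens at `V ∈ S.dom`, EVERY background field `U₀` of `V` satisfies `rootGaugeC k U₀ = rootGaugeC k (S.chartCfg V)` — uniqueness of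
the minimal orbit (Part III `uniqueUkOrbit_of_tokens_chart`, from [15] Prop. 6's uniqueness in the ball) + the background property of the chart point (Part III
`isBackground_chartCfg_of_tokens_chart`) + DEF-1's `rootGaugeC_eq_of_orbitRel`.  No selector, no wrapping gauge.  CONDITIONAL on the displayed tokens. [cite: Balaban1985Variational, Prop. 6 p.306, (174) p.306, Thm 1 p.279, (19) p.281; Balaban1987RG1, (0.21) p.256] -/
theorem rootGaugeC_eq_chartCfg_of_isBackground_of_tokens_chart (hR : S.RegimeTok) (hV : V ∈ S.dom)
    (range : ∀ A ∈ Kc, S.chart V A ∈ bgReg F N K k ε ∧ Averaging.iter (avOfRecord F N K) k (S.chart V A) = V)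
    (covers : ∀ U : GaugeField (F.P K) 0 (SU N), U ∈ bgReg F N K k ε → Averaging.iter (avOfRecord F N K) k U = V → ∃ A ∈ Kc, OrbitRel k (S.chart V A) U)
    (sol_of_isMinOn : ∀ A ∈ Kc, IsMinOn (wilsonAction4 ∘ S.chart V) Kc A → ‖A‖ ≤ S.ε₄ ∧ mapT (S.𝒢 V) 0 (S.W V) (S.J V) (S.𝔄 V) A = A)
    (star_mem : S.sol V ∈ Kc) (star_isMinOn : IsMinOn (wilsonAction4 ∘ S.chart V) Kc (S.sol V))
    {U₀ : GaugeField (F.P K) 0 (SU N)} (h₀ : IsBackground (avOfRecord F N K) (bgReg F N K k ε) k V U₀) :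
    rootGaugeC k U₀ = rootGaugeC k (S.chartCfg V) :=
  rootGaugeC_eq_rootGaugeC_of_isBackground (uniqueUkOrbit_of_tokens_chart hR hV range covers sol_of_isMinOn star_mem star_isMinOn) h₀
    (isBackground_chartCfg_of_tokens_chart range covers star_mem star_isMinOn)

/-- ★★ **THE CENTRED SELECTOR OF RECORD IS THE CENTRED CHART IMAGE OF THE FIXED POINT** (standing range `k ≤ m + K`): under the chart tokens at `V ∈ S.dom`,
`rootGaugeC k (UkSel F N K k ε V) = rootGaugeC k (S.chartCfg V)` — Part III's named map `UkSel … V = rootGauge k (S.chartCfg V)` followed by DEF-1's `rootGaugeC_rootGauge`.  With FILE B's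
`recordBgFieldC = rootGaugeC (k+1) (UkSel …)` this is the P0-bridge the centred record objects consume.  CONDITIONAL on the displayed tokens. [cite: Balaban1985Variational, Prop. 6 p.306, Thm 1 p.279, (19) p.281; Balaban1987RG1, (0.21) p.256, p.260] -/
theorem rootGaugeC_ukSel_eq_chartCfg_of_tokens_chart (hk : k ≤ (F.P K).m + (F.P K).K) (hR : S.RegimeTok) (hV : V ∈ S.dom)
    (range : ∀ A ∈ Kc, S.chart V A ∈ bgReg F N K k ε ∧ Averaging.iter (avOfRecord F N K) k (S.chart V A) = V)
    (covers : ∀ U : GaugeField (F.P K) 0 (SU N), U ∈ bgReg F N K k ε → Averaging.iter (avOfRecord F N K) k U = V → ∃ A ∈ Kc, OrbitRel k (S.chart V A) U)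
    (sol_of_isMinOn : ∀ A ∈ Kc, IsMinOn (wilsonAction4 ∘ S.chart V) Kc A → ‖A‖ ≤ S.ε₄ ∧ mapT (S.𝒢 V) 0 (S.W V) (S.J V) (S.𝔄 V) A = A)
    (star_mem : S.sol V ∈ Kc) (star_isMinOn : IsMinOn (wilsonAction4 ∘ S.chart V) Kc (S.sol V)) :
    rootGaugeC k (UkSel F N K k ε V) = rootGaugeC k (S.chartCfg V) := by
  rw [ukSel_eq_rootGauge_chartCfg_of_tokens_chart hk hR hV range covers sol_of_isMinOn star_mem star_isMinOn, rootGaugeC_rootGauge hk]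

end Scheme

end Summit.QuantumFields.YangMills.Theorems.N07P0FixedPointIsRecordMinimiser

end
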